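import Summits.CriticalPhenomena.PercolationContinuityZ3.Theorems.Transplant.FKConnectivityAllQForestDetour
import Summits.CriticalPhenomena.PercolationContinuityZ3.Theorems.Transplant.FKConnectivityAllQForestToggleE
import HarnessLib

/-!
# The TRANSVERSAL (star–edge) family: one node containing (♣)⁰ and the detour lemma, and its k = 1 specialisation

Support file (`--supports stmt-CriticalPhenomena-4575`), FK sub-lane `prim-bschramm-fk-1` (generation 32) of the post-continuity
programme; builds on p205010 (kernel theorem, internal audit signed; external expert review pending).  Two counting nodes (NOT asserted)
with their `Pos` forms, theorems otherwise; no named facts, no sorries; standard axioms.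

SETTING.  Ordered two-forest colourings `(ω, ω ∆ M)` of a fibre `(M, u₀)` (first class `ω ⊇ u₀`, second class `ω ∆ M ⊇ u₀`, both forests),
counted by `fibreCount`, as everywhere in this directory.  For a finite vertex set `Z` the event `transvEv Z` = "no two points of `Z` are
joined" (the class is `Z`-TRANSVERSAL).  For `o ∈ Z ∌ w` put
`Θ(Z;o;w) := #(Fo ∩ T_Z, Fo ∩ {o ≁ w}) − #(Fo ∩ T_{Z ∪ {w}}, Fo)` ( = `#{Z-transversal, w ∈ C(Z) first class} − #{Z-transversal, w ∈ C(o) second class}`).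

**NODE D1 `ForestTransversalOn V` (NOT asserted): `Θ(Z;o;w) ≥ 0` for all fibres, all `Z ∋ o`, `w ∉ Z`.**  Three facts (memo
bschramm/FROM-fk-1-g32-TRANSVERSAL.md):
* `Z = {o, v}`, `w = y` IS the node (♣)⁰ `AdjForestRayleighNoSqOn` at `(o; v, y)` on the fibre with `e = ov`, `f = oy` removed — proved here:
  **`adjForestRayleighNoSqOn_of_forestTransversal : ForestTransversalOn V → AdjForestRayleighNoSqOn V`** (peel `e, f`: `ω ↦ ω ∖ {e,f}` injects
  bad into `#(Fo ∩ T_{y,o,v}, Fo)`, `ω' ↦ ω' ∪ {e}` injects `#(Fo ∩ T_{o,v}, Fo ∩ {o ≁ y})` into good).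
* General `Z` is the STAR–EDGE coefficientwise negative correlation `Z_{S ∪ f}·Z ≤ Z_S·Z_f` for a star `S` at `o` and a further pair `f = ow`
  at `o` (`|S| = 1` is the node; `|S| ≥ 2` is NOT a formal consequence of it — coefficientwise inequalities of products do not cancel).
* g31's DETOUR LEMMA `DetourOn` is a SUM of D1 instances: resolved by the detour `P`, the `P`-summand is D1 on the fibre with `P` deleted and
  `e` pinned, `Z = {o} ∪ int P`; a two-step detour gives literally a node instance on a minor.  So DL is not a new primitive.
EVIDENCE (exact, exhaustive, isomorph-free; engine numerics32/dlr/dlr.c of the seat = orderly generator of g18/g31 + new leaf statistics, cross-checked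
against an independent Python enumerator on all graphs with ≤ 5 vertices): every connected simple graph with n ≤ 8 vertices, every `Z`, `o`, `w`, and the
two-class forms `A` `Z`-transversal / `B` `Y`-transversal for all `Y ⊆ Z` (6,054,996 instances): 0 failures.

**NODE MONO `ForestTransversalMonoOn V` (NOT asserted): `Θ(Z;o;w) ≥ Θ(Z ∪ {u};o;w)` whenever `u ∉ Z ∪ {w}` is joined to a point of `Z` by a
pair of the fibre.**  EVIDENCE: all connected simple graphs n ≤ 8 (46,681,080 `(Z,o,w,u)` tests with `u ∈ N(Z)`) and all multigraphs with
multiplicity ≤ 2 on ≤ 6 vertices (1,509,792): 0 failures; it is FALSE for `u ∉ N(Z)` (380,697 failures at n ≤ 8).  (For a PINNED pair `zu` the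
instance is the D1 instance of the quotient; the census covers free pairs.)  The companion file `…ForestTransversalMono` proves MONO ⇒ D1 (descend
along neighbours to the base `N(Z) ⊆ Z ∪ {w}`, settled by a last-edge injection); hence MONO ⇒ (♣)⁰ ∧ DL ∧ the whole star family.
[cite: SempleWelsh2008, Conj. 1.1 (p. 2); Thm. 4.2 (p. 11)] [cite: CibulkaHladkyLaCroixWagner2008, Thm. 1 (p. 2)] [cite: Linusson2011, Prop. 2.6]
[cite: Grimmett2006, §1.5 (p. 13)]
-/

noncomputable section

namespace Summit.CriticalPhenomena.PercolationContinuityZ3.Theorems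
namespace FK

open Set Literature.Probability.LatticeModels Literature.Probability.Percolation
open scoped Classical symmDiff

variable {V : Type*} [Fintype V]

/-! ### The transversality event -/

/-- The event "the configuration joins no two distinct points of `Z`" (`Z`-transversal class). [cite: Grimmett2006, §1.5 (p. 13)] -/
def transvEv (Z : Finset V) : Set (BondConfig V) :=
  {ω | ∀ ⦃z⦄, z ∈ Z → ∀ ⦃z'⦄, z' ∈ Z → z ≠ z' → ¬ (openGraph ω).Reachable z z'}

omit [Fintype V] in
/-- Membership in `transvEv`. [folklore] -/
theorem mem_transvEv {Z : Finset V} {ω : BondConfig V} :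
    ω ∈ transvEv Z ↔ ∀ ⦃z⦄, z ∈ Z → ∀ ⦃z'⦄, z' ∈ Z → z ≠ z' → ¬ (openGraph ω).Reachable z z' := Iff.rfl

omit [Fintype V] in
/-- Adding a point to `Z`: transversal for `Z ∪ {w}` iff transversal for `Z` and `w` is joined to no other point of `Z`. [folklore] -/
theorem mem_transvEv_insert {Z : Finset V} {w : V} {ω : BondConfig V} :
    ω ∈ transvEv (insert w Z) ↔ ω ∈ transvEv Z ∧ ∀ z ∈ Z, z ≠ w → ¬ (openGraph ω).Reachable z w := by
  constructor
  · intro h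
    exact ⟨fun z hz z' hz' hne => h (Finset.mem_insert_of_mem hz) (Finset.mem_insert_of_mem hz') hne,
      fun z hz hne => h (Finset.mem_insert_of_mem hz) (Finset.mem_insert_self w Z) hne⟩
  · rintro ⟨h1, h2⟩ z hz z' hz' hne
    obtain hzw | hzZ := Finset.mem_insert.1 hz
    · obtain hz'w | hz'Z := Finset.mem_insert.1 hz'
      · exact absurd (hzw.trans hz'w.symm) hne
      · rw [hzw]; exact fun hr => h2 z' hz'Z (fun h => hne (hzw.trans h.symm)) hr.symm
    · obtain hz'w | hz'Z := Finset.mem_insert.1 hz'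
      · rw [hz'w]; exact h2 z hzZ (fun h => hne (h.trans hz'w.symm))
      · exact h1 hzZ hz'Z hne

omit [Fintype V] in
/-- A singleton is always transversal. [folklore] -/
theorem mem_transvEv_singleton {v : V} {ω : BondConfig V} : ω ∈ transvEv ({v} : Finset V) :=
  fun _ hz _ hz' hne => absurd ((Finset.mem_singleton.1 hz).trans (Finset.mem_singleton.1 hz').symm) hne

omit [Fintype V] in
/-- Transversal for a pair `{o, v}` (`o ≠ v`) iff `o ≁ v`. [folklore] -/
theorem mem_transvEv_pair {o v : V} (hov : o ≠ v) {ω : BondConfig V} :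
    ω ∈ transvEv ({o, v} : Finset V) ↔ ¬ (openGraph ω).Reachable o v := by
  rw [mem_transvEv_insert]
  constructor
  · rintro ⟨-, h⟩ hr
    exact h v (Finset.mem_singleton_self v) (Ne.symm hov) hr.symm
  · intro h
    refine ⟨mem_transvEv_singleton, fun z hz _ hr => ?_⟩
    rw [Finset.mem_singleton.1 hz] at hr
    exact h hr.symm

omit [Fintype V] in
/-- Transversality is inherited by sub-configurations. [folklore] -/
theorem transvEv_of_subset {Z : Finset V} {ω ζ : BondConfig V} (hω : ω ∈ transvEv Z) (h : ζ ⊆ ω) : ζ ∈ transvEv Z :=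
  fun _ hz _ hz' hne hr => hω hz hz' hne (hr.mono (openGraph_mono h))

/-! ### The nodes -/

/-- **NODE D1 — the TRANSVERSAL (star–edge) inequality on the vertex type `V`** (conjecture-shaped, NOT asserted): for every fibre `(M, u₀)`,
every finite `Z ∋ o` and `w ∉ Z`: `#(Fo ∩ T_{Z ∪ {w}}, Fo) ≤ #(Fo ∩ T_Z, Fo ∩ {o ≁ w})` — among the colourings whose first class is
`Z`-transversal, `w` avoids the first-class clusters of `Z` at most as often as it avoids the second-class cluster of `o`.  `Z = {o,v}` is
(♣)⁰; in general it is the coefficientwise negative correlation of a star at `o` with a further pair at `o`.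
[cite: SempleWelsh2008, Conj. 1.1 (p. 2)] [cite: Linusson2011, Prop. 2.6] -/
def ForestTransversalOn (V : Type*) [Fintype V] : Prop :=
  ∀ (M u₀ : BondConfig V), Disjoint u₀ M → ∀ (Z : Finset V) (o w : V), o ∈ Z → w ∉ Z →
    fibreCount M u₀ (forestEv V ∩ transvEv (insert w Z)) (forestEv V) ≤
      fibreCount M u₀ (forestEv V ∩ transvEv Z) (forestEv V ∩ (reachEv o w)ᶜ)

/-- **D1 on every finite vertex type.**  CONJECTURE-SHAPED, NOT asserted (evidence in the module docstring).
[cite: SempleWelsh2008, Conj. 1.1 (p. 2); Thm. 4.2 (p. 11)] -/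
@[conjecture] def ForestTransversalPos : Prop := ∀ n : ℕ, ForestTransversalOn (Fin n)

/-- **NODE MONO — neighbour monotonicity of the transversal margin on the vertex type `V`** (conjecture-shaped, NOT asserted): for every fibre
`(M, u₀)`, `Z ∋ o`, `w ∉ Z`, and every `u ∉ Z`, `u ≠ w` joined to some `z ∈ Z` by a pair `zu ∈ M ∪ u₀`:
`Θ(Z ∪ {u};o;w) ≤ Θ(Z;o;w)`, written additively:
`#(Fo ∩ T_{Z+u}, Fo ∩ {o ≁ w}) + #(Fo ∩ T_{Z+w}, Fo) ≤ #(Fo ∩ T_Z, Fo ∩ {o ≁ w}) + #(Fo ∩ T_{Z+u+w}, Fo)`.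
[cite: SempleWelsh2008, Conj. 1.1 (p. 2)] [cite: Linusson2011, Prop. 2.6] -/
def ForestTransversalMonoOn (V : Type*) [Fintype V] : Prop :=
  ∀ (M u₀ : BondConfig V), Disjoint u₀ M → ∀ (Z : Finset V) (o w u z : V), o ∈ Z → w ∉ Z → u ∉ Z → u ≠ w → z ∈ Z → z ≠ u →
    s(z, u) ∈ M ∪ u₀ →
    fibreCount M u₀ (forestEv V ∩ transvEv (insert u Z)) (forestEv V ∩ (reachEv o w)ᶜ) +
        fibreCount M u₀ (forestEv V ∩ transvEv (insert w Z)) (forestEv V) ≤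
      fibreCount M u₀ (forestEv V ∩ transvEv Z) (forestEv V ∩ (reachEv o w)ᶜ) +
        fibreCount M u₀ (forestEv V ∩ transvEv (insert w (insert u Z))) (forestEv V)

/-- **MONO on every finite vertex type.**  CONJECTURE-SHAPED, NOT asserted (evidence in the module docstring).
[cite: SempleWelsh2008, Conj. 1.1 (p. 2); Thm. 4.2 (p. 11)] -/
@[conjecture] def ForestTransversalMonoPos : Prop := ∀ n : ℕ, ForestTransversalMonoOn (Fin n)


/-! ### The `k = 1` specialisation: D1 at `Z = {o, v}` is the node (♣)⁰ -/

section NodeOfTransversal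

variable {M₂ u₀ : BondConfig V} {o v y : V}

omit [Fintype V] in
/-- Removing the two hub pairs keeps the partner: `(ω ∖ {e,f}) ∆ M₂ = ω ∆ (M₂ ∪ {e,f})` for `e, f ∈ ω`, `e, f ∉ M₂`. [folklore] -/
theorem sdiff_pair_symmDiff_eq {ω : BondConfig V} {e f : Sym2 V} (he : e ∈ ω) (hf : f ∈ ω) (heM : e ∉ M₂) (hfM : f ∉ M₂) :
    (ω \ {e, f}) ∆ M₂ = ω ∆ insert e (insert f M₂) := by
  ext x
  simp only [Set.mem_symmDiff, mem_sdiff, mem_insert_iff, mem_singleton_iff]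
  by_cases hxe : x = e
  · subst hxe; tauto
  · by_cases hxf : x = f
    · subst hxf; tauto
    · tauto

omit [Fintype V] in
/-- Adding the hub pair `e` to a configuration avoiding `e, f` adds `f` to the partner:
`(ω' ∪ {e}) ∆ (M₂ ∪ {e,f}) = (ω' ∆ M₂) ∪ {f}`. [folklore] -/
theorem insert_symmDiff_insert_insert_eq {ω' : BondConfig V} {e f : Sym2 V} (he : e ∉ ω') (hf : f ∉ ω') (heM : e ∉ M₂) (hfM : f ∉ M₂)
    (hef : e ≠ f) : insert e ω' ∆ insert e (insert f M₂) = insert f (ω' ∆ M₂) := by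
  ext x
  simp only [Set.mem_symmDiff, mem_insert_iff]
  by_cases hxe : x = e
  · subst hxe; tauto
  · by_cases hxf : x = f
    · subst hxf; tauto
    · tauto

/-- **bad ≤ the transversal count.**  On the fibre `(M₂ ∪ {e,f}, u₀)` (`e = ov`, `f = oy` free, `o, v, y` distinct) the map `ω ↦ ω ∖ {e,f}`
injects the colourings with `e, f` in the first class into the colourings of `(M₂, u₀)` whose first class is `{y,o,v}`-transversal.
[cite: Linusson2011, Prop. 2.6] [cite: SempleWelsh2008, Conj. 1.1 (p. 2)] -/
theorem adjForestNoSq_bad_le_transversal (hov : o ≠ v) (hoy : o ≠ y) (hvy : v ≠ y)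
    (heM : s(o, v) ∉ M₂) (hfM : s(o, y) ∉ M₂) :
    fibreCount (insert s(o, v) (insert s(o, y) M₂)) u₀ (forestEv V ∩ {ω | s(o, v) ∈ ω ∧ s(o, y) ∈ ω}) (forestEv V) ≤
      fibreCount M₂ u₀ (forestEv V ∩ transvEv (insert y ({o, v} : Finset V))) (forestEv V) := by
  have hef : s(o, v) ≠ s(o, y) := fun h => hvy (Sym2.congr_right.1 h)
  refine fibreCount_le_of_injOn (fun ω => ω \ {s(o, v), s(o, y)}) (fun ω hω hA hB => ?_) (fun ω ω' _ hA _ _ hA' _ h => ?_)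
  · obtain ⟨hF, he, hf⟩ := hA
    have hF' : IsForestCfg ω := hF
    -- no `o–v` path avoiding `e`, no `o–y` path avoiding `f`
    have hωe : insert s(o, v) (ω \ {s(o, v)}) = ω := by rw [insert_sdiff_singleton, insert_eq_of_mem he]
    have hωf : insert s(o, y) (ω \ {s(o, y)}) = ω := by rw [insert_sdiff_singleton, insert_eq_of_mem hf]
    have hsep_e : ¬ (openGraph (ω \ {s(o, v)})).Reachable o v :=
      ((isForestCfg_insert_iff hov (fun h : s(o, v) ∈ ω \ {s(o, v)} => h.2 rfl)).1 (hωe.symm ▸ hF')).2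
    have hsep_f : ¬ (openGraph (ω \ {s(o, y)})).Reachable o y :=
      ((isForestCfg_insert_iff hoy (fun h : s(o, y) ∈ ω \ {s(o, y)} => h.2 rfl)).1 (hωf.symm ▸ hF')).2
    have hsub_e : ω \ {s(o, v), s(o, y)} ⊆ ω \ {s(o, v)} := sdiff_subset_sdiff_right (singleton_subset_iff.2 (mem_insert _ _))
    have hsub_f : ω \ {s(o, v), s(o, y)} ⊆ ω \ {s(o, y)} :=
      sdiff_subset_sdiff_right (singleton_subset_iff.2 (mem_insert_of_mem _ rfl))
    refine ⟨?_, ⟨forestEv_of_subset hF sdiff_subset, ?_⟩, ?_⟩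
    · rw [sdiff_sdiff, ← hω]
      congr 1
      ext x; simp only [mem_union, mem_insert_iff, mem_singleton_iff]; tauto
    · rw [mem_transvEv_insert, mem_transvEv_pair hov]
      refine ⟨fun hr => hsep_e (hr.mono (openGraph_mono hsub_e)), fun z hz hzy hr => ?_⟩
      rcases Finset.mem_insert.1 hz with rfl | hz
      · exact hsep_f (hr.mono (openGraph_mono hsub_f))
      · rw [Finset.mem_singleton.1 hz] at hr
        -- `v ~ y` avoiding `e, f` plus `f` joins `o` to `v` avoiding `e`
        have hfω : s(o, y) ∈ ω \ {s(o, v)} := ⟨hf, fun h => hef (mem_singleton_iff.1 h).symm⟩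
        have hoy' : (openGraph (ω \ {s(o, v)})).Reachable o y := ((openGraph_adj _ _ _).2 ⟨hfω, hoy⟩).reachable
        exact hsep_e (hoy'.trans (hr.mono (openGraph_mono hsub_e)).symm)
    · show (ω \ {s(o, v), s(o, y)}) ∆ M₂ ∈ forestEv V
      rw [sdiff_pair_symmDiff_eq he hf heM hfM]; exact hB
  · -- injectivity: `e, f` lie in both configurations
    have h' : ω \ {s(o, v), s(o, y)} = ω' \ {s(o, v), s(o, y)} := h
    ext x
    have hx := Set.ext_iff.1 h' x
    simp only [mem_sdiff, mem_insert_iff, mem_singleton_iff] at hx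
    by_cases hxe : x = s(o, v)
    · subst hxe; exact ⟨fun _ => hA'.2.1, fun _ => hA.2.1⟩
    · by_cases hxf : x = s(o, y)
      · subst hxf; exact ⟨fun _ => hA'.2.2, fun _ => hA.2.2⟩
      · tauto

/-- **the transversal count ≤ good.**  On the same fibre the map `ω' ↦ ω' ∪ {e}` injects the colourings of `(M₂, u₀)` with first class
`{o,v}`-transversal and second class not joining `o, y` into the colourings of `(M₂ ∪ {e,f}, u₀)` with `e` first and `f` second.
[cite: Linusson2011, Prop. 2.6] [cite: SempleWelsh2008, Conj. 1.1 (p. 2)] -/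
theorem adjForestNoSq_transversal_le_good (hov : o ≠ v) (hoy : o ≠ y) (hvy : v ≠ y)
    (heM : s(o, v) ∉ M₂) (hfM : s(o, y) ∉ M₂) (heu : s(o, v) ∉ u₀) (hfu : s(o, y) ∉ u₀) :
    fibreCount M₂ u₀ (forestEv V ∩ transvEv ({o, v} : Finset V)) (forestEv V ∩ (reachEv o y)ᶜ) ≤
      fibreCount (insert s(o, v) (insert s(o, y) M₂)) u₀ (forestEv V ∩ {ω | s(o, v) ∈ ω}) (forestEv V ∩ {ω | s(o, y) ∈ ω}) := by
  have hef : s(o, v) ≠ s(o, y) := fun h => hvy (Sym2.congr_right.1 h)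
  refine fibreCount_le_of_injOn (fun ω => insert s(o, v) ω) (fun ω hω hA hB => ?_) (fun ω ω' hω _ _ hω' _ _ h => ?_)
  · obtain ⟨hF, hT⟩ := hA
    obtain ⟨hFB, hsepB⟩ := hB
    have hsub := subset_union_of_fibre hω
    have heω : s(o, v) ∉ ω := fun h => (hsub.1 h).elim heM heu
    have hfω : s(o, y) ∉ ω := fun h => (hsub.1 h).elim hfM hfu
    have hfζ : s(o, y) ∉ ω ∆ M₂ := fun h => (hsub.2 h).elim hfM hfu
    have hsepA : ¬ (openGraph ω).Reachable o v := (mem_transvEv_pair hov).1 hT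
    have hsepB' : ¬ (openGraph (ω ∆ M₂)).Reachable o y := fun h => hsepB h
    refine ⟨?_, ⟨(isForestCfg_insert_iff hov heω).2 ⟨hF, hsepA⟩, mem_insert _ _⟩, ?_⟩
    · ext x
      have hx := Set.ext_iff.1 hω x
      simp only [mem_sdiff, mem_insert_iff] at hx ⊢
      by_cases hxe : x = s(o, v)
      · subst hxe; tauto
      · by_cases hxf : x = s(o, y)
        · subst hxf; tauto
        · tauto
    · show insert s(o, v) ω ∆ insert s(o, v) (insert s(o, y) M₂) ∈ forestEv V ∩ {ω | s(o, y) ∈ ω}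
      rw [insert_symmDiff_insert_insert_eq heω hfω heM hfM hef]
      exact ⟨(isForestCfg_insert_iff hoy hfζ).2 ⟨hFB, hsepB'⟩, mem_insert _ _⟩
  · have heω : s(o, v) ∉ ω := fun h' => ((subset_union_of_fibre hω).1 h').elim heM heu
    have heω' : s(o, v) ∉ ω' := fun h' => ((subset_union_of_fibre hω').1 h').elim heM heu
    have h' : insert s(o, v) ω = insert s(o, v) ω' := h
    rw [← insert_sdiff_self_of_notMem heω, h', insert_sdiff_self_of_notMem heω']

/-- **D1 at `Z = {o,v}`, `w = y` gives the node on the fibre `(M₂ ∪ {e,f}, u₀)`.** [cite: SempleWelsh2008, Conj. 1.1 (p. 2)] [cite: Linusson2011, Prop. 2.6] -/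
theorem adjForestNoSq_of_transversal_free (h : ForestTransversalOn V) (hd : Disjoint u₀ M₂) (hov : o ≠ v) (hoy : o ≠ y) (hvy : v ≠ y)
    (heM : s(o, v) ∉ M₂) (hfM : s(o, y) ∉ M₂) (heu : s(o, v) ∉ u₀) (hfu : s(o, y) ∉ u₀) :
    fibreCount (insert s(o, v) (insert s(o, y) M₂)) u₀ (forestEv V ∩ {ω | s(o, v) ∈ ω ∧ s(o, y) ∈ ω}) (forestEv V) ≤
      fibreCount (insert s(o, v) (insert s(o, y) M₂)) u₀ (forestEv V ∩ {ω | s(o, v) ∈ ω}) (forestEv V ∩ {ω | s(o, y) ∈ ω}) := by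
  have hoZ : o ∈ ({o, v} : Finset V) := Finset.mem_insert_self _ _
  have hyZ : y ∉ ({o, v} : Finset V) := by
    rw [Finset.mem_insert, Finset.mem_singleton]; push Not; exact ⟨Ne.symm hoy, Ne.symm hvy⟩
  exact (adjForestNoSq_bad_le_transversal hov hoy hvy heM hfM).trans
    ((h M₂ u₀ hd _ o y hoZ hyZ).trans (adjForestNoSq_transversal_le_good hov hoy hvy heM hfM heu hfu))

end NodeOfTransversal

/-- **THE TRANSVERSAL FAMILY CONTAINS THE NODE: `ForestTransversalOn V → AdjForestRayleighNoSqOn V`.**  Degenerate positions of `e, f`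
(not in the fibre, pinned, diagonal) are the trivial cases of `…ForestContractionMono`; otherwise peel `e, f` off the free part and apply D1 at
`Z = {o,v}`, `w = y`. [cite: SempleWelsh2008, Conj. 1.1 (p. 2); Thm. 4.2 (p. 11)] [cite: CibulkaHladkyLaCroixWagner2008, Thm. 1 (p. 2)]
[cite: Linusson2011, Prop. 2.6] -/
theorem adjForestRayleighNoSqOn_of_forestTransversal (h : ForestTransversalOn V) : AdjForestRayleighNoSqOn V := by
  intro M u₀ hd o v y hvy
  by_cases heM : s(o, v) ∈ M
  swap
  · by_cases heu : s(o, v) ∈ u₀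
    · exact (adjForestNoSq_bad_eq_good_of_pinned hd heu).le
    · rw [adjForestNoSq_bad_eq_zero_of_notMem heM heu]; exact Nat.zero_le _
  by_cases hfM : s(o, y) ∈ M
  swap
  · by_cases hfu : s(o, y) ∈ u₀
    · exact (adjForestNoSq_bad_eq_good_of_pinned' hd hfu).le
    · rw [adjForestNoSq_bad_eq_zero_of_notMem' hfM hfu]; exact Nat.zero_le _
  by_cases hov : o = v
  · rw [fibreCount_eq_zero_of_forall M u₀ _ _ fun ω _ hA _ => hA.1.1 _ hA.2.1 (Sym2.mk_isDiag_iff.2 hov)]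
    exact Nat.zero_le _
  by_cases hoy : o = y
  · rw [fibreCount_eq_zero_of_forall M u₀ _ _ fun ω _ hA _ => hA.1.1 _ hA.2.2 (Sym2.mk_isDiag_iff.2 hoy)]
    exact Nat.zero_le _
  -- peel `e, f`
  have heu : s(o, v) ∉ u₀ := fun h' => hd.le_bot ⟨h', heM⟩
  have hfu : s(o, y) ∉ u₀ := fun h' => hd.le_bot ⟨h', hfM⟩
  set M₂ : BondConfig V := M \ {s(o, v), s(o, y)} with hM₂
  have hM : M = insert s(o, v) (insert s(o, y) M₂) := by
    ext x
    simp only [hM₂, mem_insert_iff, mem_sdiff, mem_singleton_iff]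
    by_cases hxe : x = s(o, v)
    · subst hxe; tauto
    · by_cases hxf : x = s(o, y)
      · subst hxf; tauto
      · tauto
  have heM₂ : s(o, v) ∉ M₂ := fun h' => h'.2 (Or.inl rfl)
  have hfM₂ : s(o, y) ∉ M₂ := fun h' => h'.2 (Or.inr rfl)
  have hd₂ : Disjoint u₀ M₂ := hd.mono_right sdiff_subset
  rw [hM]
  exact adjForestNoSq_of_transversal_free h hd₂ hov hoy hvy heM₂ hfM₂ heu hfu

/-- **`ForestTransversalPos → AdjForestRayleighNoSqPos`** — the star–edge family on all finite types gives (♣)⁰, hence the lineage's chain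
(♣) ⇒ FRM ⇒ (A′) ⇒ (A) ⇒ (B′) ⇒ (B). [cite: SempleWelsh2008, Conj. 1.1 (p. 2)] [cite: Grimmett2006, Thm. 3.8 (p. 43)] -/
theorem adjForestRayleighNoSqPos_of_forestTransversalPos (h : ForestTransversalPos) : AdjForestRayleighNoSqPos :=
  fun n => adjForestRayleighNoSqOn_of_forestTransversal (h n)

end FK
end Summit.CriticalPhenomena.PercolationContinuityZ3.Theorems

end
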